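import Summits.HodgeConjecture.HodgeConjecture.Theorems.Ring2AbelianAllAndreHodgeInvariantLattice
import Summits.HodgeConjecture.HodgeConjecture.Theorems.Ring2AbelianAllAndreLiftOnPath
import Summits.HodgeConjecture.HodgeConjecture.Theorems.Ring2AbelianAllAndreTransportLatticeCM
import HarnessLib

/-!
# Ring 2 · sub-cell AbelianAll (ALL ABELIAN VARIETIES), André axis, part XVIII-f — THE HODGE-INVARIANT SUBLATTICE IS
# `D = span_ℂ Hdg^p(𝒳) + ker j_t^*` (Hodge lift, fact-free), so under `HC_CM` the lift candidate (L) says EXACTLY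
# "the Hodge classes of the total space of a CM-pointed compact pencil are algebraic modulo the classes vanishing
# on the fibres", and the transport candidate (4) says "they are algebraic ON EVERY FIBRE"

HONEST FRAMING (page 1, verbatim): **research route, not a corollary; conditional on HC_CM plus one named
minimal statement.** Cell line: research route conditional on HC_CM; not a corollary; Q11.4-sentence-2
already refuted in dim ≥ 3. Nothing in this file proves a case of the Hodge conjecture for an abelian variety.
`HC_CM` = `Theses.RankFourFaces.CMAbelianHodge` is a BINDER wherever it occurs. Seat `pub-hodge-ring2-ab-andre-2`,
gen 10 (sequel of part XVII-f; companion of parts XVIII-a…e, which read the same candidates as "hom ≡ num").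

## Notation (compact pencil `f : 𝒳 ⟶ S` of abelian `d`-folds, point `t`, `j = j_t`, degree `p`)

`T_p(Y) := span_ℂ {rational (p,p)-classes of Y}` (inline), `D_t := (j^*)⁻¹ T_p(𝒳_t)` (part XVII-f: independent of `t`),
`C_t := (j^*)⁻¹ N^p(𝒳_t)`, `R_t := N^p(𝒳) + ker j^*`.

## What is proved (theorems only; no definition, no named fact, no sorry)

§1 **`comap_hodgeSpan_map_fiberι_eq_span_hodge_sup_ker`: `D_t = T_p(𝒳) ⊔ ker j_t^*`** for every compact pencil and every
`t` — UNCONDITIONAL (the Hodge lift of part VI, `exists_hodgeClass_map_eq`: a global class whose restriction to `𝒳_t` is a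
rational `(p,p)`-class is a rational `(p,p)`-class of `𝒳` up to `ker j_t^*`; rational spanning of preimages, part XVII-b).
§2 **`comap_le_sup_iff_span_hodge_le_sup_of_hodge`**: at a fibre with `HC^p(𝒳_t)`, (L)_t ⟺ `T_p(𝒳) ≤ N^p(𝒳) ⊔ ker j_t^*`;
`comap_eq_comap_hodgeSpan_iff_span_hodge_le_comap_of_hodge`: `C_s = D` ⟺ `T_p(𝒳) ≤ C_s`. §3 node level under `HC_CM`
(BINDER): **`cmFibreAlgebraicLift_iff_span_hodge_le_sup_of_HC_CM`** — (L) ⟺ [on every compact pencil of abelian varieties,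
at every CM point `t` and every `p`: the rational `(p,p)`-classes of the TOTAL SPACE are algebraic modulo `ker j_t^*`];
**`cmAnchoredTransport_iff_span_hodge_le_comap_of_HC_CM`** — (4) ⟺ [on every CM-pointed compact pencil, every rational
`(p,p)`-class of the total space is algebraic ON EVERY FIBRE]; `HC_AV_iff_HC_CM_and_span_hodge_le_comap` (mod `h₂₁`).
READING (RING2-MAP §AbelianAll gen 10): the three faces of the `B_min` of the André axis under `HC_CM` — lattice (`C ≡ D`,
part XVII-f), hom ≡ num (Num, part XVIII-c), Hodge-mod-kernel (this part) — and the exact gap between (L) and (4):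
"algebraic on `𝒳` modulo `ker j^*`" versus "algebraic on each fibre".

References: CharlesSchnell2014Notes (Prop. 11.3.5); Voisin2007HodgeLoci (§3); DeligneHodgeII1971 (Cor. 4.1.2);
GrothendieckTopology1969 (§1); Andre1996Motifs (Lemme 6.3.1, §6.3); Abdulali1994FamiliesAV ((1.1), Lemma 6.2).
-/

noncomputable section

set_option linter.dupNamespace false

namespace Summit.HodgeConjecture.HodgeConjecture.Ring2.AbelianAll

open CategoryTheory AlgebraicGeometry
open Literature.AlgebraicGeometry Literature.AlgebraicGeometry.Motives
open Literature.AlgebraicGeometry.HodgeTheory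
open Literature.AlgebraicGeometry.Deligne1982 (cmLocus)
open Literature.AlgebraicGeometry.Andre1996 (andre1996_cmAnchoredPencil)
open Summit.HodgeConjecture.HodgeConjecture.Theses

variable {𝒳 S : SchemeOver ℂ}

/-! ## §1 `D_t = T_p(𝒳) ⊔ ker j_t^*` -/

/-- **THE HODGE-INVARIANT SUBLATTICE IS THE HODGE SPAN OF THE TOTAL SPACE PLUS THE FIBRE KERNEL:
`(j_t^*)⁻¹ T_p(𝒳_t) = T_p(𝒳) ⊔ ker j_t^*`** for every compact pencil of abelian varieties and every `t` (`⊇`: pull-backs of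
rational `(p,p)`-classes are rational `(p,p)`; `⊆`: the preimage is spanned by RATIONAL classes `W'` with `j_t^*W' ∈ T_p(𝒳_t)`
(part XVII-b), such a `j_t^*W'` is a rational `(p,p)`-class, and the Hodge lift of part VI gives a rational `(p,p)`-class `β`
of `𝒳` with `j_t^*β = j_t^*W'`). Unconditional. [cite: CharlesSchnell2014Notes, Proposition 11.3.5] [cite: Voisin2007HodgeLoci, §3]
[cite: VoisinHodgeI2002, §7.1.1] -/
theorem comap_hodgeSpan_map_fiberι_eq_span_hodge_sup_ker {d : ℕ} {f : 𝒳 ⟶ S} (hf : IsCompactAbelianPencil f d) (p : ℕ)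
    (t : ComplexPoints S) :
    (Submodule.span ℂ {c : complexBetti (fiberOver f t) (2 * p) |
        IsRationalClass c ∧ IsOfHodgeType d (fiberOver f t) (2 * p) p p c}).comap
      (complexBetti.map (fiberι f t) (2 * p)).hom =
    Submodule.span ℂ {c : complexBetti 𝒳 (2 * p) | IsRationalClass c ∧ IsOfHodgeType (d + 1) 𝒳 (2 * p) p p c} ⊔
      LinearMap.ker (complexBetti.map (fiberι f t) (2 * p)).hom := by
  have h𝒳 := hf.isSmoothProjective_total
  have hXt := hf.isSmoothProjective_fiberOver t
  set Bt := Submodule.span ℂ {c : complexBetti (fiberOver f t) (2 * p) |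
    IsRationalClass c ∧ IsOfHodgeType d (fiberOver f t) (2 * p) p p c} with hBt
  refine le_antisymm ?_ (sup_le ?_ ?_)
  · -- `⊆`: rational spanning + Hodge lift
    intro W hW
    have hBt_rat : Bt ≤ Submodule.span ℂ {c : complexBetti (fiberOver f t) (2 * p) | IsRationalClass c ∧ c ∈ Bt} :=
      Submodule.span_le.2 fun c hc ↦ Submodule.subset_span ⟨hc.1, Submodule.subset_span hc⟩
    have hspan := comap_complexBetti_map_le_span_isRationalClass h𝒳 (fiberι f t) Bt hBt_rat (W := W) hW
    refine (Submodule.span_le (p := Submodule.span ℂ {c : complexBetti 𝒳 (2 * p) |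
        IsRationalClass c ∧ IsOfHodgeType (d + 1) 𝒳 (2 * p) p p c} ⊔
      LinearMap.ker (complexBetti.map (fiberι f t) (2 * p)).hom)).2 ?_ hspan
    rintro W' ⟨hW', hW't⟩
    have hrat : IsRationalClass (complexBetti.map (fiberι f t) (2 * p) W') :=
      hW'.map (AlgPoints.mapContinuous (L := ℂ) (fiberι f t))
    have hpp : IsOfHodgeType d (fiberOver f t) (2 * p) p p (complexBetti.map (fiberι f t) (2 * p) W') :=
      isOfHodgeType_of_mem_span_hodge hXt p hW't
    obtain ⟨β, hβr, hβh, hβW⟩ := exists_hodgeClass_map_eq hXt h𝒳 (fiberι f t) W' hrat hpp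
    rw [show W' = β + (W' - β) by abel]
    refine Submodule.add_mem_sup (Submodule.subset_span ⟨hβr, hβh⟩) ?_
    rw [LinearMap.mem_ker, map_sub, sub_eq_zero]
    exact hβW.symm
  · refine Submodule.span_le.2 ?_
    rintro c ⟨hcQ, hcH⟩
    exact Submodule.subset_span ⟨hcQ.map (AlgPoints.mapContinuous (L := ℂ) (fiberι f t)),
      hcH.map_of_isSmoothProjective hXt h𝒳 (fiberι f t)⟩
  · intro κ hκ
    rw [LinearMap.mem_ker] at hκ
    change (complexBetti.map (fiberι f t) (2 * p)).hom κ ∈ Bt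
    rw [hκ]
    exact Submodule.zero_mem _

/-! ## §2 At a fibre satisfying `HC^p`: (L)_t ⟺ `T_p(𝒳) ≤ N^p(𝒳) ⊔ ker j_t^*`; `C_s = D` ⟺ `T_p(𝒳) ≤ C_s` -/

/-- **(L)_t ⟺ "the rational `(p,p)`-classes of the total space are algebraic modulo `ker j_t^*`"** at a fibre whose rational
`(p,p)`-classes are algebraic (then `C_t = D_t = T_p(𝒳) ⊔ ker j_t^*`). [cite: CharlesSchnell2014Notes, Proposition 11.3.5]
[cite: Andre1996Motifs, §5.1 (p. 25)] -/
theorem comap_le_sup_iff_span_hodge_le_sup_of_hodge {d : ℕ} {f : 𝒳 ⟶ S} (hf : IsCompactAbelianPencil f d) (p : ℕ)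
    {t : ComplexPoints S}
    (ht : ∀ c : complexBetti (fiberOver f t) (2 * p), IsRationalClass c →
      IsOfHodgeType d (fiberOver f t) (2 * p) p p c → c ∈ algebraicClasses (fiberOver f t) p) :
    (algebraicClasses (fiberOver f t) p).comap (complexBetti.map (fiberι f t) (2 * p)).hom ≤
        algebraicClasses 𝒳 p ⊔ LinearMap.ker (complexBetti.map (fiberι f t) (2 * p)).hom ↔
      Submodule.span ℂ {c : complexBetti 𝒳 (2 * p) | IsRationalClass c ∧ IsOfHodgeType (d + 1) 𝒳 (2 * p) p p c} ≤
        algebraicClasses 𝒳 p ⊔ LinearMap.ker (complexBetti.map (fiberι f t) (2 * p)).hom := by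
  rw [comap_algebraicClasses_eq_comap_hodgeSpan_of_hodge hf p ht, comap_hodgeSpan_map_fiberι_eq_span_hodge_sup_ker hf p t]
  exact ⟨fun h ↦ le_trans le_sup_left h, fun h ↦ sup_le h le_sup_right⟩

/-- **`C_s = D` ⟺ `T_p(𝒳) ≤ C_s`** ("every rational `(p,p)`-class of the total space is algebraic on the fibre `𝒳_s`"), for
every `s` — since `D = T_p(𝒳) ⊔ ker j_s^*` and `ker j_s^* ≤ C_s` always. Unconditional. [cite: DeligneHodgeII1971, Cor. 4.1.2]
[cite: GrothendieckTopology1969, §1] -/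
theorem comap_eq_comap_hodgeSpan_iff_span_hodge_le_comap {d : ℕ} {f : 𝒳 ⟶ S} (hf : IsCompactAbelianPencil f d) (p : ℕ)
    (s : ComplexPoints S) :
    (algebraicClasses (fiberOver f s) p).comap (complexBetti.map (fiberι f s) (2 * p)).hom =
        (Submodule.span ℂ {c : complexBetti (fiberOver f s) (2 * p) |
            IsRationalClass c ∧ IsOfHodgeType d (fiberOver f s) (2 * p) p p c}).comap
          (complexBetti.map (fiberι f s) (2 * p)).hom ↔
      Submodule.span ℂ {c : complexBetti 𝒳 (2 * p) | IsRationalClass c ∧ IsOfHodgeType (d + 1) 𝒳 (2 * p) p p c} ≤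
        (algebraicClasses (fiberOver f s) p).comap (complexBetti.map (fiberι f s) (2 * p)).hom := by
  rw [comap_hodgeSpan_map_fiberι_eq_span_hodge_sup_ker hf p s]
  refine ⟨fun h ↦ h ▸ le_sup_left, fun h ↦ le_antisymm ?_ (sup_le h ?_)⟩
  · rw [← comap_hodgeSpan_map_fiberι_eq_span_hodge_sup_ker hf p s]
    exact comap_algebraicClasses_le_comap_hodgeSpan hf p s
  · exact le_trans le_sup_right (algebraicClasses_sup_ker_le_comap hf p s)

/-! ## §3 Node level under `HC_CM`: (L) = "Hodge classes of the total space algebraic mod `ker j_t^*`",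
(4) = "Hodge classes of the total space algebraic on every fibre" -/

/-- **`HC_CM ⊢ (L) ⟺ [∀ compact pencils of abelian varieties, ∀ p, ∀ CM points t: T_p(𝒳) ≤ N^p(𝒳) ⊔ ker j_t^*]`** — the lift
candidate of the André axis is the Hodge conjecture for the TOTAL SPACES of CM-pointed compact pencils MODULO the classes
vanishing on the fibres. `HC_CM` is a BINDER. [cite: Andre1996Motifs, §6.3 (p. 33)] [cite: CharlesSchnell2014Notes, Proposition 11.3.5] -/
theorem cmFibreAlgebraicLift_iff_span_hodge_le_sup_of_HC_CM (hCM : RankFourFaces.CMAbelianHodge) :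
    CMFibreAlgebraicLift ↔ ∀ ⦃d : ℕ⦄ ⦃𝒳 S : SchemeOver ℂ⦄ (f : 𝒳 ⟶ S), IsCompactAbelianPencil f d →
      ∀ (p : ℕ), ∀ t ∈ cmLocus f d,
        Submodule.span ℂ {c : complexBetti 𝒳 (2 * p) | IsRationalClass c ∧ IsOfHodgeType (d + 1) 𝒳 (2 * p) p p c} ≤
          algebraicClasses 𝒳 p ⊔ LinearMap.ker (complexBetti.map (fiberι f t) (2 * p)).hom := by
  rw [cmFibreAlgebraicLift_iff_comap_le_sup]
  refine ⟨fun h d 𝒳 S f hf p t ht ↦ ?_, fun h d 𝒳 S f hf p t ht ↦ ?_⟩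
  · obtain ⟨A₀, ⟨e₀⟩, hdim, hcm⟩ := ht
    exact (comap_le_sup_iff_span_hodge_le_sup_of_hodge hf p
      (fun c hc hcpp ↦ Ring2Transport.mem_algebraicClasses_of_cmChart hCM A₀ e₀ hdim hcm hc hcpp)).1
      (h f hf p t ⟨A₀, ⟨e₀⟩, hdim, hcm⟩)
  · obtain ⟨A₀, ⟨e₀⟩, hdim, hcm⟩ := ht
    exact (comap_le_sup_iff_span_hodge_le_sup_of_hodge hf p
      (fun c hc hcpp ↦ Ring2Transport.mem_algebraicClasses_of_cmChart hCM A₀ e₀ hdim hcm hc hcpp)).2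
      (h f hf p t ⟨A₀, ⟨e₀⟩, hdim, hcm⟩)

/-- **`HC_CM ⊢ (4) ⟺ [on every compact pencil of abelian varieties with a CM fibre, ∀ p, ∀ s: T_p(𝒳) ≤ C_s]`** — every
rational `(p,p)`-class of the TOTAL SPACE is algebraic ON EVERY FIBRE (part XVII-f: (4) ⟺ `C_s = D` ∀ s; §2). `HC_CM` is a
BINDER. [cite: Andre1996Motifs, §6.3 a) (p. 33)] [cite: Abdulali1994FamiliesAV, Lemma 6.2 (p. 1131)] -/
theorem cmAnchoredTransport_iff_span_hodge_le_comap_of_HC_CM (hCM : RankFourFaces.CMAbelianHodge) :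
    CMAnchoredTransport ↔ ∀ ⦃d : ℕ⦄ ⦃𝒳 S : SchemeOver ℂ⦄ (f : 𝒳 ⟶ S) (hf : IsCompactAbelianPencil f d),
      (cmLocus f d).Nonempty → ∀ (p : ℕ) (s : ComplexPoints S),
        Submodule.span ℂ {c : complexBetti 𝒳 (2 * p) | IsRationalClass c ∧ IsOfHodgeType (d + 1) 𝒳 (2 * p) p p c} ≤
          (algebraicClasses (fiberOver f s) p).comap (complexBetti.map (fiberι f s) (2 * p)).hom := by
  rw [cmAnchoredTransport_iff_comap_eq_hodge_of_HC_CM hCM]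
  refine ⟨fun h d 𝒳 S f hf hne p s ↦ ?_, fun h d 𝒳 S f hf hne p s ↦ ?_⟩
  · exact (comap_eq_comap_hodgeSpan_iff_span_hodge_le_comap hf p s).1 (h f hf hne p s)
  · exact (comap_eq_comap_hodgeSpan_iff_span_hodge_le_comap hf p s).2 (h f hf hne p s)

/-- **`HC_AV ⟺ HC_CM ∧ [on CM-pointed compact pencils every rational (p,p)-class of the total space is algebraic on every
fibre]`**, modulo André's Lemme 6.3.1 (`h₂₁`, binder). [cite: Andre1996Motifs, Lemme 6.3.1 (p. 31) and §6.3 a) (p. 33)] -/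
theorem HC_AV_iff_HC_CM_and_span_hodge_le_comap (h₂₁ : andre1996_cmAnchoredPencil) :
    PadicSemiregularLift.HodgeAbelianVarieties ↔ RankFourFaces.CMAbelianHodge ∧
      ∀ ⦃d : ℕ⦄ ⦃𝒳 S : SchemeOver ℂ⦄ (f : 𝒳 ⟶ S) (hf : IsCompactAbelianPencil f d),
        (cmLocus f d).Nonempty → ∀ (p : ℕ) (s : ComplexPoints S),
          Submodule.span ℂ {c : complexBetti 𝒳 (2 * p) | IsRationalClass c ∧ IsOfHodgeType (d + 1) 𝒳 (2 * p) p p c} ≤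
            (algebraicClasses (fiberOver f s) p).comap (complexBetti.map (fiberι f s) (2 * p)).hom := by
  rw [HC_AV_iff_HC_CM_and_cmAnchoredTransport h₂₁]
  exact ⟨fun ⟨hCM, h4⟩ ↦ ⟨hCM, (cmAnchoredTransport_iff_span_hodge_le_comap_of_HC_CM hCM).1 h4⟩,
    fun ⟨hCM, h⟩ ↦ ⟨hCM, (cmAnchoredTransport_iff_span_hodge_le_comap_of_HC_CM hCM).2 h⟩⟩

/-- (L) ⟹ (4) read in this language: "algebraic on `𝒳` modulo `ker j_t^*`" implies "algebraic on every fibre" (restriction of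
algebraic classes is algebraic; `ker j_t^* = ker j_s^*`). The converse is the open gap between the two candidates.
[cite: Andre1996Motifs, §6.3 (p. 33)] -/
theorem span_hodge_le_comap_of_span_hodge_le_sup {d : ℕ} {f : 𝒳 ⟶ S} (hf : IsCompactAbelianPencil f d) (p : ℕ)
    (t s : ComplexPoints S)
    (h : Submodule.span ℂ {c : complexBetti 𝒳 (2 * p) | IsRationalClass c ∧ IsOfHodgeType (d + 1) 𝒳 (2 * p) p p c} ≤
      algebraicClasses 𝒳 p ⊔ LinearMap.ker (complexBetti.map (fiberι f t) (2 * p)).hom) :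
    Submodule.span ℂ {c : complexBetti 𝒳 (2 * p) | IsRationalClass c ∧ IsOfHodgeType (d + 1) 𝒳 (2 * p) p p c} ≤
      (algebraicClasses (fiberOver f s) p).comap (complexBetti.map (fiberι f s) (2 * p)).hom := by
  refine le_trans h ?_
  rw [algebraicClasses_sup_ker_eq hf p t s]
  exact algebraicClasses_sup_ker_le_comap hf p s

end Summit.HodgeConjecture.HodgeConjecture.Ring2.AbelianAll

end
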